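import Literature.Geometry.Riemannian.NashEntropy
import Literature.Geometry.Riemannian.ConjugateHeatConservation
import Literature.Geometry.Riemannian.ConjugateHeatPositivity
import Literature.Geometry.Riemannian.HeatEquationFamily
import HarnessLib

/-!
# Mass and `L²`-energy of heat and conjugate heat solutions along a Ricci flow
# (Topping 2006, §6.3, (6.3.2); Bamler 2020a, §2)

Along a Ricci flow `(g, cov)` of Riemannian metrics on `[0, T']` on a closed manifold `M`
(modelled on `ℝᵐ`) the volume form evolves by `∂ₜ dV = −R dV`, so that for every smooth
space-time function `F` one has `d/dt ∫ F dV = ∫ (∂ₜF − R F) dV` (Topping 2006, proof of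
Prop. 6.3.1 and (6.3.2), `d/dt ∫ w dV = −∫ □* w dV`; the tree's
`IsRicciFlow.hasDerivWithinAt_integral_of_contMDiffOn`). Combined with Green's identity
`∫ u Δf dV = −∫ g⁻¹(du, df) dV` (`integral_mul_laplaceBeltrami_eq_neg_integral_innerDual`) and
`∫ Δf dV = 0` (`integral_laplaceBeltrami_eq_zero`) this gives the elementary mass and energy
identities behind the `L¹ → L²` (Nash) step of heat kernel bounds on a Ricci flow background
(Bamler 2020a, §2: heat operator `□ = ∂ₜ − Δ`, conjugate heat operator `□* = −∂ₜ − Δ + R`).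
We PROVE, for a smooth heat solution `w` (`IsHeatSolutionOn g w 0 T'`, `∂ₜw = Δ_{g(t)} w`) and a
smooth conjugate heat solution `v` (`IsConjugateHeatSolutionOn g cov [0, T'] v`,
`∂ₜv = −Δ_{g(t)} v + R v`):

* `IsRicciFlow.exists_abs_scalarCurvatureWith_le` — `|R| ≤ C₀` on `M × [0, T']` for some
  `C₀ ≥ 0` (the scalar curvature is smooth on the compact space-time,
  `IsRicciFlow.contMDiffOn_scalarCurvatureWith`);
* `IsRicciFlow.hasDerivWithinAt_integral_heat` — `d/dt ∫ w dV = −∫ R w dV`;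
* `IsRicciFlow.hasDerivWithinAt_integral_sq_heat` — `d/dt ∫ w² dV = −2 ∫ |∇w|² dV − ∫ R w² dV`;
* `IsRicciFlow.integral_heat_le_exp_mul_integral` — for `w ≥ 0` and `|R| ≤ C₀`,
  `∫ w(t) dV_{g(t)} ≤ e^{C₀ t} ∫ w(0) dV_{g(0)}` (Grönwall);
* `IsRicciFlow.hasDerivWithinAt_integral_sq_conjugateHeat` —
  `d/dt ∫ v² dV = 2 ∫ |∇v|² dV + ∫ R v² dV`.

All derivatives are derivatives within `[0, T']` (one-sided at the end points), and
`|∇f|² = g⁻¹(df, df) = gradSq`. Everything is proved; there are no definitions and no named facts.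

## References

* P. Topping, *Lectures on the Ricci flow*, LMS Lecture Note Series 325, CUP 2006, §6.3,
  Prop. 6.3.1, Rem. 6.3.2, (6.3.2) (p. 57). [Topping2006]
* R. H. Bamler, *Entropy and heat kernel bounds on a Ricci flow background*, arXiv:2008.07093
  (2020), §2 (heat operator and conjugate heat operator of a Ricci flow). [Bamler2020Entropy]
-/

noncomputable section

open Bundle Set Function Filter Manifold MeasureTheory Measure TopologicalSpace
open scoped Manifold ContDiff Topology ENNReal NNReal

namespace Literature.Geometry.Riemannian

open Lorentzian Lorentzian.PseudoRiemannianMetric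

section HeatEnergy

variable {m : ℕ} {H : Type*} [TopologicalSpace H]
  {I : ModelWithCorners ℝ (EuclideanSpace ℝ (Fin m)) H} [I.Boundaryless]
  {M : Type*} [TopologicalSpace M] [ChartedSpace H M] [IsManifold I ∞ M]
  [T2Space M] [CompactSpace M] [MeasurableSpace M] [BorelSpace M]
  {g : ℝ → PseudoRiemannianMetric I ∞ (EuclideanSpace ℝ (Fin m)) (TangentSpace I : M → Type _)}
  {cov : ℝ → CovariantDerivative I (EuclideanSpace ℝ (Fin m)) (TangentSpace I : M → Type _)}

omit [T2Space M] [MeasurableSpace M] [BorelSpace M] in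
/-- **The scalar curvature of a Ricci flow on `[0, T']` on a closed manifold is bounded**:
there is `C₀ ≥ 0` with `|R(x, t)| ≤ C₀` for all `x ∈ M`, `t ∈ [0, T']` — `R` is smooth, in
particular continuous, on the compact space-time `M × [0, T']`
(`IsRicciFlow.contMDiffOn_scalarCurvatureWith`, Topping's standing convention that the flow is
smooth up to `t = 0` and `t = T'`). [cite: Topping2006, §1.2.3] -/
theorem IsRicciFlow.exists_abs_scalarCurvatureWith_le {T' : ℝ} (hT' : 0 < T')
    (hflow : IsRicciFlow g cov (Icc 0 T')) :
    ∃ C₀ : ℝ, 0 ≤ C₀ ∧ ∀ t ∈ Icc 0 T', ∀ x, |(g t).scalarCurvatureWith (cov t) x| ≤ C₀ := by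
  have hRc : ContinuousOn (fun p : M × ℝ ↦ (g p.2).scalarCurvatureWith (cov p.2) p.1)
      (univ ×ˢ Icc 0 T') := hflow.contMDiffOn_scalarCurvatureWith.continuousOn
  obtain ⟨K₀, hK₀⟩ := (isCompact_univ.prod isCompact_Icc).exists_bound_of_continuousOn hRc
  have hK : ∀ t ∈ Icc 0 T', ∀ x, |(g t).scalarCurvatureWith (cov t) x| ≤ K₀ := fun t ht x ↦ by
    have h' := hK₀ (x, t) ⟨mem_univ _, ht⟩
    rwa [Real.norm_eq_abs] at h'
  rcases isEmpty_or_nonempty M with hM | ⟨⟨x₀⟩⟩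
  · exact ⟨0, le_rfl, fun t _ x ↦ (IsEmpty.false x).elim⟩
  · -- the bound at `(x₀, 0)` shows `0 ≤ K₀`
    exact ⟨K₀, (abs_nonneg _).trans (hK 0 ⟨le_rfl, hT'.le⟩ x₀), hK⟩

/-- **`d/dt ∫ w dV = −∫ R w dV` for a heat solution along a Ricci flow** (Topping 2006, (6.3.2):
`d/dt ∫ w dV = −∫ □* w dV = ∫ (∂ₜw + Δw − Rw) dV`, with `∂ₜw = Δw` and `∫ Δw dV = 0`): for a
Ricci flow of Riemannian metrics `(g, cov)` on `[0, T']`, `0 < T'`, on a closed manifold modelled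
on `ℝᵐ` and a smooth solution `w` of `∂ₜw = Δ_{g(t)} w` on `M × [0, T']`, at every `t ∈ [0, T']`
the derivative within `[0, T']` of `r ↦ ∫ w(r) dV_{g(r)}` is `−∫ R w(t) dV_{g(t)}`.
[cite: Topping2006, §6.3, (6.3.2) (p. 57)] -/
theorem IsRicciFlow.hasDerivWithinAt_integral_heat {T' : ℝ} (hT' : 0 < T')
    (hflow : IsRicciFlow g cov (Icc 0 T')) (hR : ∀ t ∈ Icc 0 T', (g t).IsRiemannian)
    {w : ℝ → M → ℝ} (hw : IsHeatSolutionOn g w 0 T') {t : ℝ} (ht : t ∈ Icc 0 T') :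
    HasDerivWithinAt (fun r ↦ ∫ x, w r x ∂(g r).riemVolume)
      (-∫ x, (g t).scalarCurvatureWith (cov t) x * w t x ∂(g t).riemVolume) (Icc 0 T') t := by
  have h2le : (2 : ℕ∞ω) ≤ (∞ : ℕ∞ω) := WithTop.coe_le_coe.mpr le_top
  have hU : UniqueDiffOn ℝ (Icc 0 T') := uniqueDiffOn_Icc hT'
  -- `d/dt ∫ w dV = ∫ (∂ₜw − R w) dV`
  have hder := hflow.hasDerivWithinAt_integral_of_contMDiffOn (convex_Icc 0 T') hR
    (v := w) hw.1 ht
  refine hder.congr_deriv ?_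
  -- `∂ₜw = Δw`
  have hderiv : ∀ x, derivWithin (fun s ↦ w s x) (Icc 0 T') t =
      (g t).laplaceBeltrami (w t) x := fun x ↦ (hw.2 t ht x).derivWithin (hU t ht)
  have hwt : ContMDiff I 𝓘(ℝ, ℝ) ∞ (w t) := contMDiff_slice_of_contMDiffOn hw.1 ht
  have hLw : Continuous fun x ↦ (g t).laplaceBeltrami (w t) x :=
    (contMDiff_slice_of_contMDiffOn (u := fun r x ↦ (g r).laplaceBeltrami (w r) x)
      (hflow.smooth.contMDiffOn_laplaceBeltrami hU hw.1) ht).continuous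
  have hRt : Continuous fun x ↦ (g t).scalarCurvatureWith (cov t) x :=
    (contMDiff_slice_of_contMDiffOn (u := fun r x ↦ (g r).scalarCurvatureWith (cov r) x)
      hflow.contMDiffOn_scalarCurvatureWith ht).continuous
  have e1 : (fun x ↦ derivWithin (fun s ↦ w s x) (Icc 0 T') t -
      (g t).scalarCurvatureWith (cov t) x * w t x) =
      fun x ↦ (g t).laplaceBeltrami (w t) x - (g t).scalarCurvatureWith (cov t) x * w t x := by
    funext x
    rw [hderiv x]
  have hA : Integrable (fun x ↦ (g t).laplaceBeltrami (w t) x) (g t).riemVolume :=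
    (g t).integrable_of_continuous hLw
  have hB : Integrable (fun x ↦ (g t).scalarCurvatureWith (cov t) x * w t x) (g t).riemVolume :=
    (g t).integrable_of_continuous (hRt.mul hwt.continuous)
  rw [e1, integral_sub hA hB, integral_laplaceBeltrami_eq_zero (hR t ht) (hwt.of_le h2le),
    zero_sub]

/-- **`d/dt ∫ w² dV = −2 ∫ |∇w|² dV − ∫ R w² dV` for a heat solution along a Ricci flow**
(Topping 2006, (6.3.2) applied to `w²`: `d/dt ∫ w² dV = ∫ (2 w ∂ₜw − R w²) dV = ∫ (2 w Δw − R w²) dV`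
and `∫ w Δw dV = −∫ g⁻¹(dw, dw) dV = −∫ |∇w|² dV` by Green's identity): for a Ricci flow of
Riemannian metrics `(g, cov)` on `[0, T']`, `0 < T'`, on a closed manifold modelled on `ℝᵐ` and
a smooth solution `w` of `∂ₜw = Δ_{g(t)} w` on `M × [0, T']`, at every `t ∈ [0, T']` the
derivative within `[0, T']` of `r ↦ ∫ w(r)² dV_{g(r)}` is
`−2 ∫ gradSq (w t) dV_{g(t)} − ∫ R w(t)² dV_{g(t)}`. [cite: Topping2006, §6.3, (6.3.2) (p. 57)] -/
theorem IsRicciFlow.hasDerivWithinAt_integral_sq_heat {T' : ℝ} (hT' : 0 < T')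
    (hflow : IsRicciFlow g cov (Icc 0 T')) (hR : ∀ t ∈ Icc 0 T', (g t).IsRiemannian)
    {w : ℝ → M → ℝ} (hw : IsHeatSolutionOn g w 0 T') {t : ℝ} (ht : t ∈ Icc 0 T') :
    HasDerivWithinAt (fun r ↦ ∫ x, (w r x) ^ 2 ∂(g r).riemVolume)
      (-2 * ∫ x, (g t).gradSq (w t) x ∂(g t).riemVolume -
        ∫ x, (g t).scalarCurvatureWith (cov t) x * (w t x) ^ 2 ∂(g t).riemVolume) (Icc 0 T') t := by
  have h1le : (1 : ℕ∞ω) ≤ (∞ : ℕ∞ω) := WithTop.coe_le_coe.mpr le_top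
  have h2le : (2 : ℕ∞ω) ≤ (∞ : ℕ∞ω) := WithTop.coe_le_coe.mpr le_top
  have hU : UniqueDiffOn ℝ (Icc 0 T') := uniqueDiffOn_Icc hT'
  -- `w²` is smooth on `M × [0, T']`
  have hw2 : ContMDiffOn (I.prod 𝓘(ℝ, ℝ)) 𝓘(ℝ, ℝ) ∞ (fun p : M × ℝ ↦ (w p.2 p.1) ^ 2)
      (univ ×ˢ Icc 0 T') := hw.1.pow 2
  -- `d/dt ∫ w² dV = ∫ (∂ₜ(w²) − R w²) dV`
  have hder := hflow.hasDerivWithinAt_integral_of_contMDiffOn (convex_Icc 0 T') hR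
    (v := fun r x ↦ (w r x) ^ 2) hw2 ht
  refine hder.congr_deriv ?_
  -- `∂ₜ(w²) = 2 w Δw`
  have hderiv : ∀ x, derivWithin (fun s ↦ (w s x) ^ 2) (Icc 0 T') t =
      2 * w t x * (g t).laplaceBeltrami (w t) x := by
    intro x
    rw [((hw.2 t ht x).fun_pow 2).derivWithin (hU t ht)]
    norm_num
  have hwt : ContMDiff I 𝓘(ℝ, ℝ) ∞ (w t) := contMDiff_slice_of_contMDiffOn hw.1 ht
  have hLw : Continuous fun x ↦ (g t).laplaceBeltrami (w t) x :=
    (contMDiff_slice_of_contMDiffOn (u := fun r x ↦ (g r).laplaceBeltrami (w r) x)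
      (hflow.smooth.contMDiffOn_laplaceBeltrami hU hw.1) ht).continuous
  have hRt : Continuous fun x ↦ (g t).scalarCurvatureWith (cov t) x :=
    (contMDiff_slice_of_contMDiffOn (u := fun r x ↦ (g r).scalarCurvatureWith (cov r) x)
      hflow.contMDiffOn_scalarCurvatureWith ht).continuous
  have e1 : (fun x ↦ derivWithin (fun s ↦ (w s x) ^ 2) (Icc 0 T') t -
      (g t).scalarCurvatureWith (cov t) x * (w t x) ^ 2) =
      fun x ↦ 2 * (w t x * (g t).laplaceBeltrami (w t) x) -
        (g t).scalarCurvatureWith (cov t) x * (w t x) ^ 2 := by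
    funext x
    rw [hderiv x, mul_assoc]
  have hA : Integrable (fun x ↦ 2 * (w t x * (g t).laplaceBeltrami (w t) x)) (g t).riemVolume :=
    ((g t).integrable_of_continuous (hwt.continuous.mul hLw)).const_mul 2
  have hB : Integrable (fun x ↦ (g t).scalarCurvatureWith (cov t) x * (w t x) ^ 2)
      (g t).riemVolume :=
    (g t).integrable_of_continuous (hRt.mul (hwt.continuous.pow 2))
  rw [e1, integral_sub hA hB, integral_const_mul,
    integral_mul_laplaceBeltrami_eq_neg_integral_innerDual (hR t ht) (hwt.of_le h1le)
      (hwt.of_le h2le), mul_neg, neg_mul]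
  rfl

/-- **Mass bound for non-negative heat solutions along a Ricci flow with bounded scalar
curvature**: for a Ricci flow of Riemannian metrics `(g, cov)` on `[0, T']`, `0 < T'`, on a
closed manifold modelled on `ℝᵐ`, a smooth solution `w ≥ 0` of `∂ₜw = Δ_{g(t)} w` on
`M × [0, T']` and a bound `|R| ≤ C₀` on `M × [0, T']`,
`∫ w(t) dV_{g(t)} ≤ e^{C₀ t} ∫ w(0) dV_{g(0)}` for all `t ∈ [0, T']`: by (6.3.2),
`m(t) = ∫ w(t) dV_{g(t)}` has `m' = −∫ R w dV ≤ C₀ m` (`IsRicciFlow.hasDerivWithinAt_integral_heat`),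
so `e^{−C₀ t} m(t)` is non-increasing (Grönwall). [cite: Topping2006, §6.3, (6.3.2) (p. 57)] -/
theorem IsRicciFlow.integral_heat_le_exp_mul_integral {T' : ℝ} (hT' : 0 < T')
    (hflow : IsRicciFlow g cov (Icc 0 T')) (hR : ∀ t ∈ Icc 0 T', (g t).IsRiemannian)
    {w : ℝ → M → ℝ} (hw : IsHeatSolutionOn g w 0 T') (hw0 : ∀ t ∈ Icc 0 T', ∀ x, 0 ≤ w t x)
    {C₀ : ℝ} (hC₀ : ∀ t ∈ Icc 0 T', ∀ x, |(g t).scalarCurvatureWith (cov t) x| ≤ C₀)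
    {t : ℝ} (ht : t ∈ Icc 0 T') :
    ∫ x, w t x ∂(g t).riemVolume ≤ Real.exp (C₀ * t) * ∫ x, w 0 x ∂(g 0).riemVolume := by
  -- `F(r) = e^{-C₀ r} ∫ w(r) dV_{g(r)}` and its derivative within `[0, T']`
  set F : ℝ → ℝ := fun r ↦ Real.exp (-C₀ * r) * ∫ x, w r x ∂(g r).riemVolume with hF
  set F' : ℝ → ℝ := fun r ↦ Real.exp (-C₀ * r) * (-C₀ * 1) * ∫ x, w r x ∂(g r).riemVolume +
    Real.exp (-C₀ * r) * -∫ x, (g r).scalarCurvatureWith (cov r) x * w r x ∂(g r).riemVolume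
    with hF'
  have hderiv : ∀ r ∈ Icc 0 T', HasDerivWithinAt F (F' r) (Icc 0 T') r := by
    intro r hr
    have hexp : HasDerivAt (fun r' ↦ Real.exp (-C₀ * r')) (Real.exp (-C₀ * r) * (-C₀ * 1)) r :=
      ((hasDerivAt_id' r).const_mul (-C₀)).exp
    exact hexp.hasDerivWithinAt.mul (hflow.hasDerivWithinAt_integral_heat hT' hR hw hr)
  -- `F' ≤ 0` on `[0, T']`: `-∫ R w dV ≤ C₀ ∫ w dV`
  have hF'le : ∀ r ∈ Icc 0 T', F' r ≤ 0 := by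
    intro r hr
    have hwr : ContMDiff I 𝓘(ℝ, ℝ) ∞ (w r) := contMDiff_slice_of_contMDiffOn hw.1 hr
    have hRr : Continuous fun x ↦ (g r).scalarCurvatureWith (cov r) x :=
      (contMDiff_slice_of_contMDiffOn (u := fun r' x ↦ (g r').scalarCurvatureWith (cov r') x)
        hflow.contMDiffOn_scalarCurvatureWith hr).continuous
    have hle : -∫ x, (g r).scalarCurvatureWith (cov r) x * w r x ∂(g r).riemVolume ≤
        C₀ * ∫ x, w r x ∂(g r).riemVolume := by
      rw [← integral_neg, ← integral_const_mul]
      refine integral_mono ((g r).integrable_of_continuous (hRr.mul hwr.continuous)).neg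
        (((g r).integrable_of_continuous hwr.continuous).const_mul C₀) fun x ↦ ?_
      have h1 : -((g r).scalarCurvatureWith (cov r) x * w r x) ≤
          |(g r).scalarCurvatureWith (cov r) x| * w r x := by
        rw [← neg_mul]
        exact mul_le_mul_of_nonneg_right (neg_le_abs _) (hw0 r hr x)
      exact h1.trans (mul_le_mul_of_nonneg_right (hC₀ r hr x) (hw0 r hr x))
    have hpos : 0 < Real.exp (-C₀ * r) := Real.exp_pos _
    have hcalc : F' r = Real.exp (-C₀ * r) *
        (-∫ x, (g r).scalarCurvatureWith (cov r) x * w r x ∂(g r).riemVolume -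
          C₀ * ∫ x, w r x ∂(g r).riemVolume) := by
      rw [hF']
      ring
    rw [hcalc]
    exact mul_nonpos_of_nonneg_of_nonpos hpos.le (sub_nonpos.2 hle)
  -- hence `F` is non-increasing on `[0, T']`
  have hcont : ContinuousOn F (Icc 0 T') := fun r hr ↦ (hderiv r hr).continuousWithinAt
  have hanti : AntitoneOn F (Icc 0 T') :=
    antitoneOn_of_hasDerivWithinAt_nonpos (convex_Icc 0 T') hcont
      (fun r hr ↦ (hderiv r (interior_subset hr)).mono interior_subset)
      fun r hr ↦ hF'le r (interior_subset hr)
  have h0 : (0 : ℝ) ∈ Icc 0 T' := ⟨le_rfl, hT'.le⟩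
  have hFt : F t ≤ F 0 := hanti h0 ht ht.1
  have hF0 : F 0 = ∫ x, w 0 x ∂(g 0).riemVolume := by
    simp [hF]
  have hone : Real.exp (C₀ * t) * Real.exp (-C₀ * t) = 1 := by
    rw [← Real.exp_add]
    simp [neg_mul]
  calc ∫ x, w t x ∂(g t).riemVolume
      = Real.exp (C₀ * t) * F t := by
        rw [hF, ← mul_assoc, hone, one_mul]
    _ ≤ Real.exp (C₀ * t) * F 0 := mul_le_mul_of_nonneg_left hFt (Real.exp_pos _).le
    _ = Real.exp (C₀ * t) * ∫ x, w 0 x ∂(g 0).riemVolume := by rw [hF0]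

/-- **`d/dt ∫ v² dV = 2 ∫ |∇v|² dV + ∫ R v² dV` for a conjugate heat solution along a Ricci
flow** (Topping 2006, (6.3.2) applied to `v²` with `∂ₜv = −Δv + Rv`, the conjugate heat equation
`□* v = 0`, `□* = −∂ₜ − Δ + R` of Bamler 2020a, §2: `d/dt ∫ v² dV = ∫ (2 v ∂ₜv − R v²) dV =
∫ (−2 v Δv + R v²) dV` and `−∫ v Δv dV = ∫ |∇v|² dV` by Green's identity): for a Ricci flow of
Riemannian metrics `(g, cov)` on `[0, T']`, `0 < T'`, on a closed manifold modelled on `ℝᵐ` and a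
smooth conjugate heat solution `v` on `M × [0, T']`, at every `t ∈ [0, T']` the derivative within
`[0, T']` of `r ↦ ∫ v(r)² dV_{g(r)}` is `2 ∫ gradSq (v t) dV_{g(t)} + ∫ R v(t)² dV_{g(t)}`.
[cite: Topping2006, §6.3, (6.3.2) (p. 57)] -/
theorem IsRicciFlow.hasDerivWithinAt_integral_sq_conjugateHeat {T' : ℝ} (hT' : 0 < T')
    (hflow : IsRicciFlow g cov (Icc 0 T')) (hR : ∀ t ∈ Icc 0 T', (g t).IsRiemannian)
    {v : ℝ → M → ℝ} (hv : IsConjugateHeatSolutionOn g cov (Icc 0 T') v) {t : ℝ}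
    (ht : t ∈ Icc 0 T') :
    HasDerivWithinAt (fun r ↦ ∫ x, (v r x) ^ 2 ∂(g r).riemVolume)
      (2 * ∫ x, (g t).gradSq (v t) x ∂(g t).riemVolume +
        ∫ x, (g t).scalarCurvatureWith (cov t) x * (v t x) ^ 2 ∂(g t).riemVolume) (Icc 0 T') t := by
  have h1le : (1 : ℕ∞ω) ≤ (∞ : ℕ∞ω) := WithTop.coe_le_coe.mpr le_top
  have h2le : (2 : ℕ∞ω) ≤ (∞ : ℕ∞ω) := WithTop.coe_le_coe.mpr le_top
  have hU : UniqueDiffOn ℝ (Icc 0 T') := uniqueDiffOn_Icc hT'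
  -- `v²` is smooth on `M × [0, T']`
  have hv2 : ContMDiffOn (I.prod 𝓘(ℝ, ℝ)) 𝓘(ℝ, ℝ) ∞ (fun p : M × ℝ ↦ (v p.2 p.1) ^ 2)
      (univ ×ˢ Icc 0 T') := hv.1.pow 2
  -- `d/dt ∫ v² dV = ∫ (∂ₜ(v²) − R v²) dV`
  have hder := hflow.hasDerivWithinAt_integral_of_contMDiffOn (convex_Icc 0 T') hR
    (v := fun r x ↦ (v r x) ^ 2) hv2 ht
  refine hder.congr_deriv ?_
  -- `∂ₜ(v²) = 2 v (−Δv + Rv)`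
  have hderiv : ∀ x, derivWithin (fun s ↦ (v s x) ^ 2) (Icc 0 T') t =
      2 * v t x * (-(g t).laplaceBeltrami (v t) x +
        (g t).scalarCurvatureWith (cov t) x * v t x) := by
    intro x
    have hdv : HasDerivWithinAt (fun s ↦ v s x)
        (-(g t).laplaceBeltrami (v t) x + (g t).scalarCurvatureWith (cov t) x * v t x)
        (Icc 0 T') t := by
      have h0 := hasDerivWithinAt_time_of_contMDiffOn (by simp) hv.1 x ht
      rwa [hv.2 t ht x] at h0
    rw [(hdv.fun_pow 2).derivWithin (hU t ht)]
    norm_num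
  have hvt : ContMDiff I 𝓘(ℝ, ℝ) ∞ (v t) := contMDiff_slice_of_contMDiffOn hv.1 ht
  have hLv : Continuous fun x ↦ (g t).laplaceBeltrami (v t) x :=
    (contMDiff_slice_of_contMDiffOn (u := fun r x ↦ (g r).laplaceBeltrami (v r) x)
      (hflow.smooth.contMDiffOn_laplaceBeltrami hU hv.1) ht).continuous
  have hRt : Continuous fun x ↦ (g t).scalarCurvatureWith (cov t) x :=
    (contMDiff_slice_of_contMDiffOn (u := fun r x ↦ (g r).scalarCurvatureWith (cov r) x)
      hflow.contMDiffOn_scalarCurvatureWith ht).continuous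
  have e1 : (fun x ↦ derivWithin (fun s ↦ (v s x) ^ 2) (Icc 0 T') t -
      (g t).scalarCurvatureWith (cov t) x * (v t x) ^ 2) =
      fun x ↦ -2 * (v t x * (g t).laplaceBeltrami (v t) x) +
        (g t).scalarCurvatureWith (cov t) x * (v t x) ^ 2 := by
    funext x
    rw [hderiv x]
    ring
  have hA : Integrable (fun x ↦ -2 * (v t x * (g t).laplaceBeltrami (v t) x)) (g t).riemVolume :=
    ((g t).integrable_of_continuous (hvt.continuous.mul hLv)).const_mul (-2)
  have hB : Integrable (fun x ↦ (g t).scalarCurvatureWith (cov t) x * (v t x) ^ 2)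
      (g t).riemVolume :=
    (g t).integrable_of_continuous (hRt.mul (hvt.continuous.pow 2))
  rw [e1, integral_add hA hB, integral_const_mul,
    integral_mul_laplaceBeltrami_eq_neg_integral_innerDual (hR t ht) (hvt.of_le h1le)
      (hvt.of_le h2le), mul_neg, neg_mul, neg_neg]
  rfl

end HeatEnergy

end Literature.Geometry.Riemannian

end
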